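import Summits.QuantumFields.QCD.Theorems.GapBuysCauchyRateRotationRestorationDefs
import Summits.QuantumFields.QCD.Theorems.QuarksAsStableActionStableActionBridgeStubOffDiagonalTensorDensity
import HarnessLib

/-!
# Stub `stub_separatedTensorsTotal : SeparatedTensorsTotal` (S3 of line `registered`, reshape r1,
crux stmt-QuantumFields-8840 `RotationRestoration`) — PROVED

Separated real tensors are total in `⁰𝒮((ℝ⁴)ⁿ)`: two continuous linear functionals `T₁, T₂` on
`𝓢(((ℝ⁴)ⁿ), ℂ)` that agree on every complexified real tensor `f₁ ⊗ ⋯ ⊗ fₙ` whose factors are compactly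
supported with pairwise disjoint topological supports (`IsSeparated f`) agree on every test function flat
on the coincidence locus (`IsOffDiagonal F`).  Pure Schwartz-space analysis, no QCD.

Proof — the engine of `StableActionBridge.Sketch.stub_offDiagonalTensorDensity`
(`QuarksAsStableActionStableActionBridgeStubOffDiagonalTensorDensity`), with its target set (off-diagonal
real tensors) replaced by the set of SEPARATED real tensors
`{G | ∃ f, IsSeparated f ∧ IsTensorOf G (ofRealTest ∘ f)}`:

1. `separated_boxTensors_subset` — the box tensors of `mem_closure_span_boxTensors` over pairwise
   disjoint bounded blocks ARE separated: each factor is supported in a bounded block of `ℝ⁴` (closed and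
   bounded, hence compact support, Heine–Borel in `ℝ⁴`), and the supports inherit the disjointness of the
   blocks;
2. `separated_piece_mem_closure` — one piece `η_β u` of the lattice partition of unity of a test function
   `u` supported at pairwise distances `≥ δ > 12 h` lies in the closed span (box engine over the outer
   blocks `∏_c ((β_{ic} - 2) h, (β_{ic} + 2) h)`, pairwise disjoint);
3. `separated_mem_closure_of_separatedSupport` — summing the pieces (`tendsto_latticeWindow_smul`);
4. `mem_closure_span_separated_of_isOffDiagonal` — every `F ∈ ⁰𝒮` is a Schwartz limit of such `u`
   (`exists_separated_tendsto_of_isOffDiagonal`);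
5. `stub_separatedTensorsTotal` — `T₁ = T₂` on the set, hence on the closure of its span
   (`ContinuousLinearMap.eqOn_closure_span`), which contains `F`.

References: K. Osterwalder, R. Schrader, Comm. Math. Phys. 31 (1973) 83–112, §2 (the spaces `⁰𝒮`,
`𝒮(ℝ^{4n}) = ⊗̂ⁿ 𝒮(ℝ⁴)`); the partition-of-unity / Fourier-series density proof is textbook folklore.
-/

noncomputable section

namespace Summit.QuantumFields.QCD.Cruxes.RotationRestoration.Birth

open scoped BigOperators Topology SchwartzMap
open Filter Set
open Literature.MathematicalPhysics.QuantumLattice Literature.MathematicalPhysics.AQFT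
open Summit.QuantumFields.YangMills.Cruxes.OSLegsAtWeakCouplingC.Sketch (Separated
  exists_separated_tendsto_of_isOffDiagonal)

namespace SeparatedTensorsTotal

/-- **Box tensors over pairwise disjoint blocks are separated real tensors.**  If the per-particle blocks
`{x | ∀ c, x_c ∈ (l_{ic}, u_{ic})}` of `B : BoxData n 4` (identity coordinates on `ℝ⁴`) are pairwise
disjoint, every element of `B.boxTensors` — a tensor `g₁ ⊗ ⋯ ⊗ gₙ` of real test functions with
`supp gᵢ ⊆ block i` — is the tensor of a separated family: `tsupport gᵢ` is closed and lies in the bounded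
block `i` (inside the closed ball of radius `√4 · ∑_c (|l_{ic}| + |u_{ic}|)`), hence is compact
(Heine–Borel in `ℝ⁴`), and the supports are pairwise disjoint because the blocks are. [folklore] -/
theorem separated_boxTensors_subset {n : ℕ} (B : BoxData n 4)
    (hdisj : ∀ i j : Fin n, i ≠ j →
      Disjoint {x : EuclideanSpace ℝ (Fin 4) |
          ∀ c, ((ContinuousLinearEquiv.refl ℝ (EuclideanSpace ℝ (Fin 4))) x) c ∈
            Ioo (B.l (i, c)) (B.u (i, c))}
        {x : EuclideanSpace ℝ (Fin 4) |
          ∀ c, ((ContinuousLinearEquiv.refl ℝ (EuclideanSpace ℝ (Fin 4))) x) c ∈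
            Ioo (B.l (j, c)) (B.u (j, c))}) :
    B.boxTensors (ContinuousLinearEquiv.refl ℝ (EuclideanSpace ℝ (Fin 4))) ⊆
      {G : 𝓢((Fin n → EuclideanSpace ℝ (Fin 4)), ℂ) |
        ∃ f : Fin n → 𝓢(EuclideanSpace ℝ (Fin 4), ℝ), IsSeparated f ∧
          IsTensorOf G (fun i => ofRealTest (f i))} := by
  rintro G ⟨g, hg, hG⟩
  refine ⟨g, ⟨fun i => ?_, fun i j hij => (hdisj i j hij).mono (hg i) (hg j)⟩, hG⟩
  -- compact support: `tsupport (g i)` is closed and lies in a closed ball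
  set r : ℝ := ∑ c : Fin 4, (|B.l (i, c)| + |B.u (i, c)|) with hr
  have hr0 : 0 ≤ r := Finset.sum_nonneg fun c _ => by positivity
  have hsub : tsupport (g i : EuclideanSpace ℝ (Fin 4) → ℝ) ⊆
      Metric.closedBall (0 : EuclideanSpace ℝ (Fin 4)) (√(Fintype.card (Fin 4) : ℝ) * r) := by
    intro x hx
    have hxb : ∀ c, x c ∈ Ioo (B.l (i, c)) (B.u (i, c)) := hg i hx
    rw [mem_closedBall_zero_iff]
    refine Literature.MathematicalPhysics.QuantumLattice.EuclideanSpace.norm_le_sqrt_card_mul x hr0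
      fun c => ?_
    have h1 := hxb c
    have h2 : |B.l (i, c)| + |B.u (i, c)| ≤ r :=
      Finset.single_le_sum (f := fun c => |B.l (i, c)| + |B.u (i, c)|) (fun c _ => by positivity)
        (Finset.mem_univ c)
    rw [abs_le]
    constructor
    · linarith [h1.1, neg_abs_le (B.l (i, c)), abs_nonneg (B.u (i, c))]
    · linarith [h1.2, le_abs_self (B.u (i, c)), abs_nonneg (B.l (i, c))]
  exact (isCompact_closedBall _ _).of_isClosed_subset (isClosed_tsupport _) hsub

/-- **One piece of the lattice partition of a separated test function lies in the closed span of the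
separated real tensors.**  For `u` supported at pairwise particle distances `≥ δ`
(`tsupport u ⊆ Separated n δ`), `0 < h`, `12 h < δ` and `β ∈ ℤ^{4n}`, the piece `η_β · u` (`η_β` the lattice
bump of `SchwartzPartition` in the mesh coordinates at scale `h`) belongs to the closure of the span of the
separated real tensors: it is supported in the closed box `∏ [(β_{ic} - 1) h, (β_{ic} + 1) h]`; unless it
vanishes this box contains a point `v` with `dist (v i) (v j) ≥ δ` (`i ≠ j`), so the outer blocks
`∏_c ((β_{ic} - 2) h, (β_{ic} + 2) h)` are pairwise disjoint (two points of blocks `i`, `j` with a common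
value force `dist (v i) (v j) ≤ √4 · 6 h = 12 h < δ`); conclude by the box engine
`mem_closure_span_boxTensors` and `separated_boxTensors_subset`. [folklore] -/
theorem separated_piece_mem_closure {n : ℕ} {u : 𝓢((Fin n → EuclideanSpace ℝ (Fin 4)), ℂ)}
    {δ h : ℝ} (hu : tsupport (u : (Fin n → EuclideanSpace ℝ (Fin 4)) → ℂ) ⊆ Separated n δ)
    (hh : 0 < h) (hhδ : 12 * h < δ) (β : Fin (n * 4) → ℤ) :
    SchwartzMap.smulLeftCLM ℂ (fun y => ((latticeBump (meshCoord n 4 h hh) β y : ℝ) : ℂ)) u ∈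
      closure ((Submodule.span ℂ
        {G : 𝓢((Fin n → EuclideanSpace ℝ (Fin 4)), ℂ) |
          ∃ f : Fin n → 𝓢(EuclideanSpace ℝ (Fin 4), ℝ), IsSeparated f ∧
            IsTensorOf G (fun i => ofRealTest (f i))} :
          Submodule ℂ 𝓢((Fin n → EuclideanSpace ℝ (Fin 4)), ℂ)) :
        Set 𝓢((Fin n → EuclideanSpace ℝ (Fin 4)), ℂ)) := by
  -- adapted from `StableActionBridge.Sketch.offDiag_piece_mem_closure`
  -- (`QuarksAsStableActionStableActionBridgeStubOffDiagonalTensorDensity`), itself adapted from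
  -- `IsTimeOrdered.smulLeftCLM_latticeBump_translate_mem_closure` (`SchwartzOrderedWedgeDensity`)
  set G := SchwartzMap.smulLeftCLM ℂ (fun y => ((latticeBump (meshCoord n 4 h hh) β y : ℝ) : ℂ)) u
    with hG
  -- the box of `β` in the coordinates `v_i^c`
  obtain ⟨b, hb⟩ : ∃ b : Fin n × Fin 4 → ℝ, ∀ ic, b ic = ((β (finProdFinEquiv ic) : ℤ) : ℝ) :=
    ⟨_, fun _ => rfl⟩
  have hbox : ∀ v ∈ tsupport (G : (Fin n → EuclideanSpace ℝ (Fin 4)) → ℂ), ∀ ic : Fin n × Fin 4,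
      b ic * h - h ≤ v ic.1 ic.2 ∧ v ic.1 ic.2 ≤ b ic * h + h := by
    intro v hv ic
    have h1 := (SchwartzMap.tsupport_smulLeftCLM_subset (F := ℂ) _ u hv).2
    rw [tsupport_latticeBumpC (meshCoord n 4 h hh) β] at h1
    have h2 := tsupport_latticeBump_subset (meshCoord n 4 h hh) β h1 (finProdFinEquiv ic)
    rw [meshCoord_apply, mem_Icc, ← hb ic] at h2
    constructor
    · have h3 : b ic - 1 ≤ v ic.1 ic.2 / h := by linarith [h2.1]
      rw [le_div_iff₀ hh] at h3
      linarith
    · have h3 : v ic.1 ic.2 / h ≤ b ic + 1 := by linarith [h2.2]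
      rw [div_le_iff₀ hh] at h3
      linarith
  -- the zero piece
  by_cases hG0 : G = 0
  · rw [hG0]
    exact subset_closure (Submodule.zero_mem _)
  -- otherwise a point of the support of `u` lies in the box
  obtain ⟨v, hv⟩ : ∃ v, G v ≠ 0 := by
    by_contra hcon
    push Not at hcon
    exact hG0 (SchwartzMap.ext hcon)
  have hvbox := hbox v (subset_tsupport _ hv)
  have huv : u v ≠ 0 := by
    rw [hG, SchwartzMap.smulLeftCLM_apply_apply
      (hasTemperateGrowth_latticeBumpC (meshCoord n 4 h hh) β)] at hv
    exact right_ne_zero_of_smul hv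
  have hsep : ∀ i j : Fin n, i ≠ j → δ ≤ dist (v i) (v j) := hu (subset_tsupport _ huv)
  -- the nested boxes
  let B : BoxData n 4 :=
    { l := fun ic => b ic * h - 2 * h, u := fun ic => b ic * h + 2 * h
      l' := fun ic => b ic * h - h, u' := fun ic => b ic * h + h
      hl := fun ic => by linarith, hl' := fun ic => by linarith, hu := fun ic => by linarith }
  let Λ₀ : EuclideanSpace ℝ (Fin 4) ≃L[ℝ] EuclideanSpace ℝ (Fin 4) := ContinuousLinearEquiv.refl ℝ _
  have hF' : tsupport (G : (Fin n → EuclideanSpace ℝ (Fin 4)) → ℂ) ⊆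
      {v | ∀ ic : Fin n × Fin 4, (Λ₀ (v ic.1)) ic.2 ∈ Icc (B.l' ic) (B.u' ic)} :=
    fun v hv ic => hbox v hv ic
  -- the outer blocks are pairwise disjoint
  have hdisj : ∀ i j : Fin n, i ≠ j →
      Disjoint {x : EuclideanSpace ℝ (Fin 4) | ∀ c, (Λ₀ x) c ∈ Ioo (B.l (i, c)) (B.u (i, c))}
        {x : EuclideanSpace ℝ (Fin 4) | ∀ c, (Λ₀ x) c ∈ Ioo (B.l (j, c)) (B.u (j, c))} := by
    intro i j hij
    refine Set.disjoint_left.2 fun y hyi hyj => ?_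
    have hc : ∀ c, |(v i - v j) c| ≤ 6 * h := fun c => by
      have h1 : b (i, c) * h - 2 * h < y c ∧ y c < b (i, c) * h + 2 * h := hyi c
      have h2 : b (j, c) * h - 2 * h < y c ∧ y c < b (j, c) * h + 2 * h := hyj c
      have h3 := hvbox (i, c)
      have h4 := hvbox (j, c)
      dsimp only at h3 h4
      rw [PiLp.sub_apply, abs_le]
      constructor <;> linarith [h1.1, h1.2, h2.1, h2.2, h3.1, h3.2, h4.1, h4.2]
    have hdist : dist (v i) (v j) ≤ 12 * h := by
      have h0 := Literature.MathematicalPhysics.QuantumLattice.EuclideanSpace.norm_le_sqrt_card_mul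
        (v i - v j) (by positivity : (0 : ℝ) ≤ 6 * h) hc
      rw [Fintype.card_fin, show ((4 : ℕ) : ℝ) = 2 ^ 2 by norm_num, Real.sqrt_sq (by norm_num)] at h0
      rw [dist_eq_norm]
      linarith
    have h5 := hsep i j hij
    linarith
  exact closure_mono (Submodule.span_mono (separated_boxTensors_subset B hdisj))
    (mem_closure_span_boxTensors Λ₀ B G hF')

/-- **A test function supported at pairwise distances `≥ δ > 0` lies in the closed span of the separated
real tensors.**  If `tsupport u ⊆ Separated n δ` with `δ > 0`, then `u` is in the closure of the span: the
lattice partition of unity at mesh `δ / 24` converges on Schwartz space, `∑_{β ∈ [-R, R]^{4n}} η_β u = W_R u → u`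
(`tendsto_latticeWindow_smul`), and every piece `η_β u` lies in the closed span
(`separated_piece_mem_closure`), which is a closed submodule. [folklore] -/
theorem separated_mem_closure_of_separatedSupport {n : ℕ}
    {u : 𝓢((Fin n → EuclideanSpace ℝ (Fin 4)), ℂ)} {δ : ℝ} (hδ : 0 < δ)
    (hu : tsupport (u : (Fin n → EuclideanSpace ℝ (Fin 4)) → ℂ) ⊆ Separated n δ) :
    u ∈ closure ((Submodule.span ℂ
        {G : 𝓢((Fin n → EuclideanSpace ℝ (Fin 4)), ℂ) |
          ∃ f : Fin n → 𝓢(EuclideanSpace ℝ (Fin 4), ℝ), IsSeparated f ∧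
            IsTensorOf G (fun i => ofRealTest (f i))} :
          Submodule ℂ 𝓢((Fin n → EuclideanSpace ℝ (Fin 4)), ℂ)) :
        Set 𝓢((Fin n → EuclideanSpace ℝ (Fin 4)), ℂ)) := by
  -- adapted from `StableActionBridge.Sketch.offDiag_mem_closure_of_separated`
  -- (`QuarksAsStableActionStableActionBridgeStubOffDiagonalTensorDensity`)
  have hC : IsClosed (closure ((Submodule.span ℂ
      {G : 𝓢((Fin n → EuclideanSpace ℝ (Fin 4)), ℂ) |
        ∃ f : Fin n → 𝓢(EuclideanSpace ℝ (Fin 4), ℝ), IsSeparated f ∧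
          IsTensorOf G (fun i => ofRealTest (f i))} :
        Submodule ℂ 𝓢((Fin n → EuclideanSpace ℝ (Fin 4)), ℂ)) :
      Set 𝓢((Fin n → EuclideanSpace ℝ (Fin 4)), ℂ))) := isClosed_closure
  have hh : (0 : ℝ) < δ / 24 := by positivity
  set Λ := meshCoord n 4 (δ / 24) hh
  -- the lattice partition of unity at mesh `δ / 24`: `∑_β η_β · u = W_R · u → u`
  have hlim : Tendsto (fun R : ℕ => ∑ β ∈ latticeCube (n * 4) R,
      SchwartzMap.smulLeftCLM ℂ (fun y => ((latticeBump Λ β y : ℝ) : ℂ)) u) atTop (𝓝 u) := by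
    have hsum : ∀ R : ℕ, ∑ β ∈ latticeCube (n * 4) R,
        SchwartzMap.smulLeftCLM ℂ (fun y => ((latticeBump Λ β y : ℝ) : ℂ)) u =
          SchwartzMap.smulLeftCLM ℂ (fun y => ((latticeWindow Λ R y : ℝ) : ℂ)) u := by
      intro R
      have hW : (fun y => ((latticeWindow Λ R y : ℝ) : ℂ)) =
          fun y => ∑ β ∈ latticeCube (n * 4) R, ((latticeBump Λ β y : ℝ) : ℂ) := by
        funext y
        rw [← sum_latticeCube_latticeBump Λ R y, Complex.ofReal_sum]
      rw [hW, SchwartzMap.smulLeftCLM_sum fun β _ => hasTemperateGrowth_latticeBumpC Λ β,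
        FunLike.coe_sum, Finset.sum_apply]
    simp_rw [hsum]
    exact tendsto_latticeWindow_smul Λ ℂ u
  refine hC.mem_of_tendsto hlim (Eventually.of_forall fun R => ?_)
  -- every piece lies in the closed span
  exact (Submodule.span ℂ {G : 𝓢((Fin n → EuclideanSpace ℝ (Fin 4)), ℂ) |
      ∃ f : Fin n → 𝓢(EuclideanSpace ℝ (Fin 4), ℝ), IsSeparated f ∧
        IsTensorOf G (fun i => ofRealTest (f i))}).topologicalClosure.sum_mem fun β _ =>
    separated_piece_mem_closure hu hh (by linarith) β

/-- **Separated real tensors are total in `⁰𝒮((ℝ⁴)ⁿ)` (closure form).**  Every `F ∈ ⁰𝒮((ℝ⁴)ⁿ)`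
(`IsOffDiagonal F`) lies in the closure, in `𝓢(((ℝ⁴)ⁿ), ℂ)`, of the `ℂ`-span of the complexified real
tensors `f₁ ⊗ ⋯ ⊗ fₙ` with `IsSeparated f`: `F` is the Schwartz limit of compactly supported cutoffs
supported at pairwise distances `≥ δ_m > 0` (`exists_separated_tendsto_of_isOffDiagonal`), each of which lies
in the closed span (`separated_mem_closure_of_separatedSupport`).  (OS 1973 §2.) [folklore] -/
theorem mem_closure_span_separated_of_isOffDiagonal {n : ℕ}
    (F : 𝓢((Fin n → EuclideanSpace ℝ (Fin 4)), ℂ)) (hF : IsOffDiagonal F) :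
    F ∈ closure ((Submodule.span ℂ
        {G : 𝓢((Fin n → EuclideanSpace ℝ (Fin 4)), ℂ) |
          ∃ f : Fin n → 𝓢(EuclideanSpace ℝ (Fin 4), ℝ), IsSeparated f ∧
            IsTensorOf G (fun i => ofRealTest (f i))} :
          Submodule ℂ 𝓢((Fin n → EuclideanSpace ℝ (Fin 4)), ℂ)) :
        Set 𝓢((Fin n → EuclideanSpace ℝ (Fin 4)), ℂ)) := by
  -- adapted from `StableActionBridge.Sketch.stub_offDiagonalTensorDensity`
  obtain ⟨u, -, hsep, hlim⟩ := exists_separated_tendsto_of_isOffDiagonal F hF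
  refine isClosed_closure.mem_of_tendsto hlim (Eventually.of_forall fun m => ?_)
  obtain ⟨δ, hδ, hδsupp⟩ := hsep m
  exact separated_mem_closure_of_separatedSupport hδ hδsupp

end SeparatedTensorsTotal

/-- **Registered stub `stub_separatedTensorsTotal` (S3) — separated real tensors are total in `⁰𝒮`
(PROVED).**  Two continuous linear functionals on `𝓢(((ℝ⁴)ⁿ), ℂ)` agreeing on the complexified real
tensors with compactly supported, pairwise disjoint factors agree on the set of such tensors, hence on
the closure of its `ℂ`-span (`ContinuousLinearMap.eqOn_closure_span`: linearity, then continuity), which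
contains every `F ∈ ⁰𝒮` (`SeparatedTensorsTotal.mem_closure_span_separated_of_isOffDiagonal`). -/
theorem stub_separatedTensorsTotal : SeparatedTensorsTotal := by
  intro n T₁ T₂ h F hF
  have hEq : Set.EqOn T₁ T₂ {G : 𝓢((Fin n → EuclideanSpace ℝ (Fin 4)), ℂ) |
      ∃ f : Fin n → 𝓢(EuclideanSpace ℝ (Fin 4), ℝ), IsSeparated f ∧
        IsTensorOf G (fun i => ofRealTest (f i))} := by
    rintro G ⟨f, hf, hG⟩
    exact h f hf G hG
  exact ContinuousLinearMap.eqOn_closure_span hEq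
    (SeparatedTensorsTotal.mem_closure_span_separated_of_isOffDiagonal F hF)

end Summit.QuantumFields.QCD.Cruxes.RotationRestoration.Birth

end
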